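import Summits.CriticalPhenomena.PercolationContinuityZ3.Theorems.PercNearOneGluingNoHeavyQuantFarTreeBlockCombCell
import Summits.CriticalPhenomena.PercolationContinuityZ3.Theorems.PercNearOneGluingNoHeavyQuantFarTreeRow
import HarnessLib

/-!
# QUANT lane R8: the block-comb bare-leaf cell of FAR in the ROUTE vocabulary (tree-supported bond weights on `Sym2 (Fin n)`)

builds on p205010 (kernel theorem, internal audit signed; external expert review pending)

Support file (`--supports stmt-CriticalPhenomena-4575`), QUANT lane seat prim-quant-p1 (gen 7); memo `run/shared/lean/prim/quant/P1-SURPLUS.md` §18.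
The wrapper of `Quant.farTree_blockComb_cell` (`…QuantFarTreeBlockCombCell.lean`) along `Quant.tree_relayCount_transfer` /
`Quant.tree_real_openConn_eq_prod` / `Quant.tree_ancestor_axioms`, in the pattern of `Quant.farRelayRow_tree_of_farTreeRow_notMem`.  Theorems only; no sorries.

* `Quant.farRelayRow_tree_blockComb_cell` — **body of `Quant.FarRelayRow` at EVERY layer** for every weight function on `Sym2 (Fin n)` supported on a
  rooted spanning tree (`par`/`depth` coordinates, weight `0` prunes) whose relay set `A ∌ o` contains a distinguished relay `a` such that, writing
  `anc x = {par^[i] x | i ≤ depth x}` for the root path of `x` (given as a hypothesis on `P`): relays below `a` are joined to `a` by weight-one edges;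
  for relays `b, b'` not below `a` the sets of vertices `y ∈ anc b ∖ anc a` whose parent edge `s(par y, y)` has weight `< 1` are equal or disjoint
  (glued blocks hanging anywhere off `a`'s root path, spine relays, single hairs); and `a`'s own edge weight is at most the product of the edge weights
  along `anc b ∖ anc a` (the bare-leaf cell).  Then `2j < Σ_{b∈A} P(o ↔ b)` and `P(o ↮ a) ≤ t` give `P(#{b ∈ A | o ↔ b} ≤ j) ≤ t`.
[cite: KozmaNitzan2024, Lemma 2 (p. 6), Conjecture 3 (p. 15)]; the family theorem is [this work].
-/

noncomputable section

namespace Summit.CriticalPhenomena.PercolationContinuityZ3.Theorems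

namespace Quant

open Finset MeasureTheory
open Literature.Probability.LatticeModels
open Literature.Probability.Percolation
open scoped Classical

variable {n : ℕ}

/-- **FAR at every layer for block-combs in the bare-leaf cell, route vocabulary.**  Tree-supported weights `w` on `Sym2 (Fin n)` (root `o`,
coordinates `par`/`depth`, `hsupp`); `P x = {par^[i] x | i ≤ depth x}` the root paths (`x ≠ o`); relays `A ∌ o` with `a ∈ A`; (glue) for `b ∈ A`
below `a`, every `y ∈ P b ∖ P a` has `w s(par y, y) = 1`; (block-comb) for `b, b' ∈ A` not below `a` the sets `{y ∈ P b ∖ P a | w s(par y, y) ≠ 1}`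
are equal or disjoint; (bare leaf) `w s(par a, a) ≤ ∏_{y ∈ P b ∖ P a} w s(par y, y)` for `b` not below `a`.  Then `2j < Σ_{b∈A} P(o ↔ b)` and
`P(o ↮ a) ≤ t` imply `P(#{b ∈ A | o ↔ b} ≤ j) ≤ t`. [this work] -/
theorem farRelayRow_tree_blockComb_cell (n : ℕ) (w : Sym2 (Fin n) → unitInterval) (o : Fin n)
    (depth : Fin n → ℕ) (par : Fin n → Fin n)
    (hroot : ∀ x, x ≠ o → depth x = 0 → par x = o)
    (hstep : ∀ x, x ≠ o → depth x ≠ 0 → par x ≠ o ∧ depth (par x) + 1 = depth x)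
    (hsupp : ∀ e, w e ≠ 0 → e.IsDiag ∨ ∃ x, x ≠ o ∧ e = s(par x, x))
    (P : Fin n → Finset (Fin n)) (hP : ∀ x, x ≠ o → P x = (Finset.range (depth x + 1)).image (fun i => par^[i] x))
    (A : Finset (Fin n)) (hoA : o ∉ A) (a : Fin n) (haA : a ∈ A) (j : ℕ) (t : ℝ)
    (hglue : ∀ b ∈ A, a ∈ P b → ∀ y ∈ P b, y ∉ P a → w s(par y, y) = 1)
    (hshape : ∀ b ∈ A, ∀ b' ∈ A, a ∉ P b → a ∉ P b' →
      (P b \ P a).filter (fun y => w s(par y, y) ≠ 1) = (P b' \ P a).filter (fun y => w s(par y, y) ≠ 1) ∨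
        Disjoint ((P b \ P a).filter fun y => w s(par y, y) ≠ 1) ((P b' \ P a).filter fun y => w s(par y, y) ≠ 1))
    (hbare : ∀ b ∈ A, a ∉ P b → (w s(par a, a) : ℝ) ≤ ∏ y ∈ P b \ P a, (w s(par y, y) : ℝ))
    (hEN : (2 * j : ℝ) < ∑ b ∈ A, (prodBernoulli w).real (openConn o b))
    (hta : (prodBernoulli w).real (openConn o a : Set (BondConfig (Fin n)))ᶜ ≤ t) :
    (prodBernoulli w).real {ω : BondConfig (Fin n) | (A.filter fun b => ω ∈ openConn o b).card ≤ j} ≤ t := by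
  rw [tree_relayCount_transfer n w o depth par hroot hstep hsupp A j]
  set q : Fin n → unitInterval := fun x => if x = o then 1 else w s(par x, x) with hq
  set P' : Fin n → Finset (Fin n) :=
    fun x => if x = o then {o} else (Finset.range (depth x + 1)).image (fun i => par^[i] x) with hP'
  obtain ⟨h1, h2, h3⟩ := tree_ancestor_axioms o depth par hstep
  have hAo : ∀ b ∈ A, b ≠ o := fun b hb hbo => hoA (hbo ▸ hb)
  have hao : a ≠ o := hAo a haA
  have hPP : ∀ b, b ≠ o → P' b = P b := fun b hb => by rw [hP b hb]; simp only [hP', if_neg hb]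
  -- members of a root path are not the root
  have hmem_ne : ∀ b, b ≠ o → ∀ y ∈ P b, y ≠ o := by
    intro b hb y hy
    rw [hP b hb, Finset.mem_image] at hy
    obtain ⟨i, hi, rfl⟩ := hy
    exact (tree_iterate_par o depth par hstep b hb i (by have := Finset.mem_range.1 hi; omega)).1
  have hqy : ∀ y, y ≠ o → q y = w s(par y, y) := fun y hy => by simp only [hq, if_neg hy]
  -- the event
  have hevent : ∀ b, b ≠ o → ∀ ω' : Set (Fin n),
      (b = o ∨ ∀ i, i ≤ depth b → par^[i] b ∈ ω') ↔ ((P' b : Finset (Fin n)) : Set (Fin n)) ⊆ ω' := by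
    intro b hbo ω'
    simp only [hbo, false_or, hP', if_neg hbo, Finset.coe_image, Finset.coe_range, Set.image_subset_iff]
    constructor
    · intro h i hi
      exact h i (by simpa [Nat.lt_succ_iff] using hi)
    · intro h i hi
      exact h (show i ∈ Set.Iio (depth b + 1) by simpa [Nat.lt_succ_iff] using hi)
  have hset : {ω' : Set (Fin n) | (A.filter fun b => b = o ∨ ∀ i, i ≤ depth b → par^[i] b ∈ ω').card ≤ j} =
      {ω' : Set (Fin n) | (A.filter fun b => ((P' b : Finset (Fin n)) : Set (Fin n)) ⊆ ω').card ≤ j} := by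
    ext ω'
    simp only [Set.mem_setOf_eq]
    rw [Finset.filter_congr fun b hb => hevent b (hAo b hb) ω']
  rw [hset]
  -- the marginals
  have hmarg : ∀ b ∈ A, ∏ y ∈ P' b, (q y : ℝ) = (prodBernoulli w).real (openConn o b) := by
    intro b hb
    have hbo := hAo b hb
    rw [tree_real_openConn_eq_prod n w o depth par hroot hstep hsupp b hbo]
    have hPb : P' b = (Finset.range (depth b + 1)).image (fun i => par^[i] b) := by simp only [hP', if_neg hbo]
    rw [hPb, Finset.prod_image (tree_iterate_injOn o depth par hstep b hbo)]
    refine Finset.prod_congr rfl fun i hi => ?_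
    have hne := (tree_iterate_par o depth par hstep b hbo i (by have := Finset.mem_range.1 hi; omega)).1
    simp [hq, hne]
  have hEN' : (2 * j : ℝ) < ∑ b ∈ A, ∏ y ∈ P' b, (q y : ℝ) := by
    rw [Finset.sum_congr rfl hmarg]; exact hEN
  have ht' : 1 - ∏ y ∈ P' a, (q y : ℝ) ≤ t := by
    rw [hmarg a haA, ← probReal_compl_eq_one_sub (Set.toFinite _).measurableSet]
    exact hta
  -- the shape hypotheses in `P'`/`q` coordinates
  have hfilt : ∀ b, b ≠ o →
      (P' b \ P' a).filter (fun y => q y ≠ 1) = (P b \ P a).filter (fun y => w s(par y, y) ≠ 1) := by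
    intro b hb
    rw [hPP b hb, hPP a hao]
    refine Finset.filter_congr fun y hy => ?_
    rw [hqy y (hmem_ne b hb y (Finset.mem_sdiff.1 hy).1)]
  have hglue' : ∀ b ∈ A, a ∈ P' b → ∀ y ∈ P' b, y ∉ P' a → q y = 1 := by
    intro b hb hab y hy hya
    rw [hPP b (hAo b hb)] at hab hy
    rw [hPP a hao] at hya
    rw [hqy y (hmem_ne b (hAo b hb) y hy)]
    exact hglue b hb hab y hy hya
  have hshape' : ∀ b ∈ A, ∀ b' ∈ A, a ∉ P' b → a ∉ P' b' →
      (P' b \ P' a).filter (fun y => q y ≠ 1) = (P' b' \ P' a).filter (fun y => q y ≠ 1) ∨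
        Disjoint ((P' b \ P' a).filter fun y => q y ≠ 1) ((P' b' \ P' a).filter fun y => q y ≠ 1) := by
    intro b hb b' hb' hab hab'
    rw [hPP b (hAo b hb)] at hab
    rw [hPP b' (hAo b' hb')] at hab'
    rw [hfilt b (hAo b hb), hfilt b' (hAo b' hb')]
    exact hshape b hb b' hb' hab hab'
  have hbare' : ∀ b ∈ A, a ∉ P' b → (q a : ℝ) ≤ ∏ y ∈ P' b \ P' a, (q y : ℝ) := by
    intro b hb hab
    rw [hPP b (hAo b hb)] at hab
    rw [hqy a hao, hPP b (hAo b hb), hPP a hao]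
    rw [Finset.prod_congr rfl fun y hy => by rw [hqy y (hmem_ne b (hAo b hb) y (Finset.mem_sdiff.1 hy).1)]]
    exact hbare b hb hab
  exact farTree_blockComb_cell P' h1 q A j t a haA hglue' hshape' hbare' hEN' ht'

/-- **The same with the observer allowed among the relays** (`o ∈ A` is the cell `(A ∖ o, j − 1)` of the previous theorem; `a ≠ o`). [this work] -/
theorem farRelayRow_tree_blockComb_cell_root (n : ℕ) (w : Sym2 (Fin n) → unitInterval) (o : Fin n)
    (depth : Fin n → ℕ) (par : Fin n → Fin n)
    (hroot : ∀ x, x ≠ o → depth x = 0 → par x = o)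
    (hstep : ∀ x, x ≠ o → depth x ≠ 0 → par x ≠ o ∧ depth (par x) + 1 = depth x)
    (hsupp : ∀ e, w e ≠ 0 → e.IsDiag ∨ ∃ x, x ≠ o ∧ e = s(par x, x))
    (P : Fin n → Finset (Fin n)) (hP : ∀ x, x ≠ o → P x = (Finset.range (depth x + 1)).image (fun i => par^[i] x))
    (A : Finset (Fin n)) (a : Fin n) (haA : a ∈ A) (hao : a ≠ o) (j : ℕ) (t : ℝ)
    (hglue : ∀ b ∈ A, b ≠ o → a ∈ P b → ∀ y ∈ P b, y ∉ P a → w s(par y, y) = 1)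
    (hshape : ∀ b ∈ A, ∀ b' ∈ A, b ≠ o → b' ≠ o → a ∉ P b → a ∉ P b' →
      (P b \ P a).filter (fun y => w s(par y, y) ≠ 1) = (P b' \ P a).filter (fun y => w s(par y, y) ≠ 1) ∨
        Disjoint ((P b \ P a).filter fun y => w s(par y, y) ≠ 1) ((P b' \ P a).filter fun y => w s(par y, y) ≠ 1))
    (hbare : ∀ b ∈ A, b ≠ o → a ∉ P b → (w s(par a, a) : ℝ) ≤ ∏ y ∈ P b \ P a, (w s(par y, y) : ℝ))
    (hEN : (2 * j : ℝ) < ∑ b ∈ A, (prodBernoulli w).real (openConn o b))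
    (hta : (prodBernoulli w).real (openConn o a : Set (BondConfig (Fin n)))ᶜ ≤ t) :
    (prodBernoulli w).real {ω : BondConfig (Fin n) | (A.filter fun b => ω ∈ openConn o b).card ≤ j} ≤ t := by
  by_cases ho : o ∈ A
  swap
  · exact farRelayRow_tree_blockComb_cell n w o depth par hroot hstep hsupp P hP A ho a haA j t
      (fun b hb => hglue b hb (fun h => ho (h ▸ hb)))
      (fun b hb b' hb' => hshape b hb b' hb' (fun h => ho (h ▸ hb)) (fun h => ho (h ▸ hb')))
      (fun b hb => hbare b hb (fun h => ho (h ▸ hb))) hEN hta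
  have ht0 : 0 ≤ t := le_trans measureReal_nonneg hta
  have hcard := QuantCensus.card_filter_conn_eq_erase_add_one A o ho
  have hsum := QuantCensus.sum_conn_eq_one_add_erase w A o ho
  have hoA' : o ∉ A.erase o := Finset.notMem_erase o A
  have haA' : a ∈ A.erase o := Finset.mem_erase.2 ⟨hao, haA⟩
  rcases Nat.eq_zero_or_pos j with hj | hj
  · subst hj
    have hempty : {ω : BondConfig (Fin n) | (A.filter fun b => ω ∈ openConn o b).card ≤ 0} = ∅ := by
      rw [Set.eq_empty_iff_forall_notMem]
      intro ω hω
      have h1 := hcard ω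
      have h2 : (A.filter fun b => ω ∈ openConn o b).card ≤ 0 := hω
      omega
    rw [hempty, measureReal_empty]
    exact ht0
  · obtain ⟨j', rfl⟩ : ∃ j', j = j' + 1 := ⟨j - 1, by omega⟩
    have hEN' : (2 * j' : ℝ) < ∑ b ∈ A.erase o, (prodBernoulli w).real (openConn o b : Set (BondConfig (Fin n))) := by
      push_cast at hEN
      linarith
    have hfar := farRelayRow_tree_blockComb_cell n w o depth par hroot hstep hsupp P hP (A.erase o) hoA' a haA' j' t
      (fun b hb => hglue b (Finset.mem_of_mem_erase hb) (Finset.ne_of_mem_erase hb))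
      (fun b hb b' hb' => hshape b (Finset.mem_of_mem_erase hb) b' (Finset.mem_of_mem_erase hb')
        (Finset.ne_of_mem_erase hb) (Finset.ne_of_mem_erase hb'))
      (fun b hb => hbare b (Finset.mem_of_mem_erase hb) (Finset.ne_of_mem_erase hb)) hEN' hta
    have hset : {ω : BondConfig (Fin n) | (A.filter fun b => ω ∈ openConn o b).card ≤ j' + 1} =
        {ω | ((A.erase o).filter fun b => ω ∈ openConn o b).card ≤ j'} := by
      ext ω
      simp only [Set.mem_setOf_eq]
      rw [hcard ω]
      omega
    rw [hset]
    exact hfar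

end Quant

end Summit.CriticalPhenomena.PercolationContinuityZ3.Theorems

end
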